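import Summits.BirchSwinnertonDyer.Rank1Residual.Additive.X4MThreeUpperHalfTowerFree
import HarnessLib

/-!
# Every Kodaira-`I₀*` row at `p = 3`: the `3`-adic tower from surj(3) — unconditionally on (G-ord),
# modulo Wuthrich's Lemma 20 (named fact A9, good case) on the potentially SUPERSINGULAR `e = 2` rows
# (cell `b2b-bsdres`, team n1011, seat p14, OWNERS row T-b1 kernel piece 4)

HONEST FRAMING (cell `b2b-bsdres`, run/shared/lean/b2b/bsd-rank1-residual/, verbatim in every
file): the goal of the cell is to DELETE the COMBINATION-SHAPED residual classes of the
Birch–Swinnerton-Dyer formula for ALL analytic-rank `≤ 1` elliptic curves over `ℚ` — "full BSD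
formula for every rank `≤ 1` curve in class `C`" assembled STRICTLY from published theorems — so
that the rank-`≤ 1` remainder becomes exactly the CONSTRUCTION-SHAPED classes, which are TYPED
(missing-input `Prop`s), NOT attempted. This is not "finishing BSD". Team n1011 (N10 / N11, the
additive block X4 ∧ `p = 3`): research route on the CONSTRUCTION-SHAPED class X4; no claim beyond the
stated classes; the label X4 is UNCHANGED by this file; nothing is booked. Theorems only (no
definition, no named fact minted; every published input is an explicit named-fact hypothesis).

## What this file proves

Delbourgo's hypothesis (G) at `p = 3` (`TypeG W 3`: good reduction over a subfield of `ℚ(ζ₃)`) is,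
for `E` additive at `3`, EQUIVALENT to "the twist `E^{(−3)}` has good reduction at `3`"
(additive-p2 `typeG_three_iff_good_twist`; Kodaira `I₀*`, `e = 2`,
`padicValInt_minimalDiscriminantInt_eq_six_of_typeG`). On the ORDINARY part the tower is a theorem
(`ClassX4Gord.towerSurj_three_of_surj`, p249389). On the SUPERSINGULAR part the twist model `Wd` is a
curve with GOOD reduction at `3` and `ρ̄_{Wd,3}` onto, i.e. exactly the remaining printed case of
Wuthrich 2014 Lemma 20 — so, granted that lemma as the NAMED FACT
`Wuthrich2014.lemma20_surjective_threeAdic_of_semistable` (registry A9, PUB; its good-ordinary and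
multiplicative cases are theorems, lit-kato gen 7), the tower of `Wd`, hence of `W`
(`GaloisImage.hasSurjectiveModNGaloisRep_pow_iff_of_model_twist`), follows from surj(3):

* `TypeG.towerSurj_three_of_surj_of_lemma20` — `TypeG W 3 → Addv W 3 → Surj W 3 → ∀ n, ρ̄_{E,3ⁿ}` onto
  (binder `hL20`); `ClassX4.towerSurj_three_of_surj_of_typeG_or_potMult_of_lemma20` — the whole
  `e = 2` locus (M) ∪ (G) of X4 at `3`;
* `X4RankZero.missingUpperBoundAt_three_of_katoSharp_of_typeG_of_lemma20` — on X4 ∧ (G) ∧ `r_an = 0`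
  ∧ surj(3) the sharp Kato reading (A161 `hKatoS`) gives the upper half from `ord₃ ∏ c_ℓ = ord₃ c₃`
  and a Manin datum with NO tower certificate (binder `hL20` instead); `…bsdp_three…_of_shaAn_unit…`.

So at `p = 3` a per-pair tower CERTIFICATE (`j`-witness / surj(9) / (ram)) is needed only on the rows
with `e ≠ 2` (Kodaira II, III, IV, IV*, III*, II*: potentially good with `e ∈ {3, 4, 6, 12}`); on the
`I₀*` rows it is replaced by nothing ((M), (G-ord)) or by the published Lemma 20 ((G-ss)). Census
(T-b1 engine 1, seat dir `HOME/b2b-bsdres-n1011-p14/tb1/`): of the 117 893 X4@3 r0 residue cells,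
Kodaira `I₀*` and potentially good supersingular: 2 683. X4 stays CONSTRUCTION-SHAPED; nothing booked.

References: Wuthrich 2014 [Wuthrich2014] Lemma 20 (p. 399); Delbourgo 1998 [Delbourgo1998] §1.5
hypothesis (G) (p. 130); Kato 2004 [Kato2004Asterisque] Thm. 14.5 (3) (p. 236), (12.5.2) (p. 222);
Silverman *AEC* X.5 Cor. 5.4, VII.5 Prop. 5.1; Miller 2011 [Miller2011LMS] Def. 1.1.
-/

noncomputable section

open scoped Classical

open WeierstrassCurve Literature.NumberTheory.EllipticCurves
  Literature.NumberTheory.EllipticCurves.ModularForms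
  Literature.NumberTheory.EllipticCurves.Rank1Residual
  Literature.NumberTheory.EllipticCurves.Rank1Residual.Typed

namespace Summit.BirchSwinnertonDyer.Rank1Residual.Additive

variable {W : WeierstrassCurve ℚ} [W.IsElliptic] [W.IsGloballyMinimal]

/-- **(G) at `p = 3` (Kodaira `I₀*`): the tower of `E` from surj(3), modulo Wuthrich's Lemma 20 on
the GOOD twist.** For `E/ℚ` additive at `3` satisfying Delbourgo's (G) and with `ρ̄_{E,3}` onto:
`ρ̄_{E,3ⁿ}` is onto for every `n`, granted `hL20` (applied to the globally minimal model `Wd` of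
`E^{(−3)}`, which has GOOD reduction at `3` by `hasGoodReductionAtPrime_twist_three_of_typeG_of_addv`
and `ρ̄_{Wd,3}` onto by `surj_iff_of_model_twist`), transported back along the twist. On the
ordinary part `hL20` is not needed (`ClassX4Gord.towerSurj_three_of_surj`).
[cite: Wuthrich2014, Lemma 20 (p. 399)] [cite: SilvermanAEC2009, X.5 Cor. 5.4 and VII.5 Prop. 5.1] -/
theorem TypeG.towerSurj_three_of_surj_of_lemma20 [Fact (Nat.Prime 3)]
    (hL20 : Wuthrich2014.lemma20_surjective_threeAdic_of_semistable)
    (hG : TypeG W 3) (hadd : Addv W 3) (hsurj : Surj W 3) (n : ℕ) :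
    W.HasSurjectiveModNGaloisRep (3 ^ n : ℕ) := by
  have hd : ((-1 : ℚ) ^ ((3 : ℕ) / 2) * (3 : ℕ)) ≠ 0 := pStar_ne_zero 3
  haveI := W.isElliptic_quadraticTwist hd
  obtain ⟨C₁, hCmin⟩ :=
    hasGlobalMinimalModel_rat_holds (W.quadraticTwist ((-1 : ℚ) ^ ((3 : ℕ) / 2) * (3 : ℕ)))
  haveI := hCmin
  set Wd := C₁ • W.quadraticTwist ((-1 : ℚ) ^ ((3 : ℕ) / 2) * (3 : ℕ)) with hWd_def
  have hWd : C₁ • W.quadraticTwist ((-1 : ℚ) ^ ((3 : ℕ) / 2) * (3 : ℕ)) = Wd := rfl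
  have hgood : Wd.HasGoodReductionAtPrime 3 :=
    hasGoodReductionAtPrime_twist_three_of_typeG_of_addv W hG hadd Wd ⟨C₁, hWd⟩
  have hsd : Surj Wd 3 := (surj_iff_of_model_twist W 3 hd ⟨C₁, hWd⟩).mpr hsurj
  exact (GaloisImage.hasSurjectiveModNGaloisRep_pow_iff_of_model_twist W 3 hd ⟨C₁, hWd⟩ n).mp
    (hL20 Wd (Or.inl hgood) hsd n)

/-- **The whole `e = 2` locus of X4 at `3` — (M) ∪ (G): the tower from surj(3)**, unconditionally on
(M) (`ClassX4M.towerSurj_of_surj`) and modulo `hL20` on (G). [cite: Wuthrich2014, Lemma 20 (p. 399)]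
[cite: Kato2004Asterisque, (12.5.2) in Thm. 12.5 (4) (p. 222)] -/
theorem ClassX4.towerSurj_three_of_surj_of_typeG_or_potMult_of_lemma20 [Fact (Nat.Prime 3)]
    (hL20 : Wuthrich2014.lemma20_surjective_threeAdic_of_semistable)
    (hX : ClassX4 W 3) (hGM : TypeG W 3 ∨ padicValRat 3 W.j < 0) (hsurj : Surj W 3) (n : ℕ) :
    W.HasSurjectiveModNGaloisRep (3 ^ n : ℕ) := by
  rcases hGM with hG | hneg
  · exact TypeG.towerSurj_three_of_surj_of_lemma20 hL20 hG hX.2.1 hsurj n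
  · exact AdditivePotMult.ClassX4M.towerSurj_of_surj ⟨hX, hX.2.1, hneg⟩ hsurj n

/-- **X4 ∧ (G) ∧ `p = 3` ∧ `r_an = 0` ∧ surj(3): the sharp Kato upper half with NO tower certificate**
— `X4RankZero.missingUpperBoundAt_of_katoSharp` (A161 `hKatoS`, GZK, modularity; `ord₃ ∏ c_ℓ =
ord₃ c₃`; a Manin datum `D` with `3 ∤ c_D`) fed with the tower of
`TypeG.towerSurj_three_of_surj_of_lemma20` (binder `hL20`). On (G-ord) rows the component route
(`ClassX4Gord.missingUpperBoundAt_three_of_katoComponent_of_surj`) needs neither `hL20` nor the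
Tamagawa / Manin bits; this theorem is for the (G)-SUPERSINGULAR `I₀*` rows.
[cite: Kato2004Asterisque, Thm. 14.5 (3) (p. 236), Prop. 14.16 (2) (p. 244)] [cite: Wuthrich2014, Lemma 20 (p. 399)]
[cite: Miller2011LMS, Def. 1.1] -/
theorem X4RankZero.missingUpperBoundAt_three_of_katoSharp_of_typeG_of_lemma20 [Fact (Nat.Prime 3)]
    (hKatoS : Kato2004.rankZero_padicValNat_sha_le_sub_localTamagawa_of_additive_potGood_of_imageContainsSL2)
    (hGZK : rank_eq_analyticRank_of_analyticRank_le_one) (hmod : hasEntireLFunction_rat)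
    (hL20 : Wuthrich2014.lemma20_surjective_threeAdic_of_semistable)
    (hr : W.analyticRank = 0) (hX : ClassX4 W 3) (hG : TypeG W 3) (hsurj : Surj W 3)
    (htam : padicValNat 3 W.tamagawaProduct =
      padicValNat 3 ((W.baseChange ℚ_[3]).localTamagawaNumber ℤ_[3]))
    {N : ℕ} [NeZero N] (D : ModularParametrizationData W N) (hc : ¬ (3 : ℤ) ∣ D.maninConstant) :
    MissingUpperBoundAt W 3 :=
  X4RankZero.missingUpperBoundAt_of_katoSharp W 3 hKatoS hGZK hmod hr hX
    (padicValRat_j_nonneg_of_typeG W 3 hG)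
    (TypeG.towerSurj_three_of_surj_of_lemma20 hL20 hG hX.2.1 hsurj) htam D hc

/-- **`BSD(E,3)` on X4 ∧ (G) ∧ `r_an = 0` ∧ surj(3) ∧ `ord₃ ∏ c_ℓ = ord₃ c₃` ∧ Manin datum ∧
`3 ∤ #Ш_an`, with NO tower certificate** (binder `hL20`). [cite: Kato2004Asterisque, Thm. 14.5 (3) (p. 236)]
[cite: Wuthrich2014, Lemma 20 (p. 399)] [cite: Miller2011LMS, §1 and Def. 1.1] -/
theorem X4RankZero.bsdp_three_of_katoSharp_of_typeG_of_lemma20_of_shaAn_unit [Fact (Nat.Prime 3)]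
    (hKatoS : Kato2004.rankZero_padicValNat_sha_le_sub_localTamagawa_of_additive_potGood_of_imageContainsSL2)
    (hGZK : rank_eq_analyticRank_of_analyticRank_le_one) (hmod : hasEntireLFunction_rat)
    (hL20 : Wuthrich2014.lemma20_surjective_threeAdic_of_semistable)
    (hr : W.analyticRank = 0) (hX : ClassX4 W 3) (hG : TypeG W 3) (hsurj : Surj W 3)
    (htam : padicValNat 3 W.tamagawaProduct =
      padicValNat 3 ((W.baseChange ℚ_[3]).localTamagawaNumber ℤ_[3]))
    {N : ℕ} [NeZero N] (D : ModularParametrizationData W N) (hc : ¬ (3 : ℤ) ∣ D.maninConstant)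
    {q : ℚ} (hq : shaAn W = (q : ℂ)) (hv : padicValRat 3 q = 0) : BSDp W 3 :=
  bsdp_of_missingPPartAt W 3 hGZK (by rw [hr]; exact zero_le_one)
    (missingPPartAt_of_upper_of_shaAn_unit W 3
      (X4RankZero.missingUpperBoundAt_three_of_katoSharp_of_typeG_of_lemma20 hKatoS hGZK hmod hL20 hr hX
        hG hsurj htam D hc) hq hv)

end Summit.BirchSwinnertonDyer.Rank1Residual.Additive

end
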